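import Mathlib
import HarnessLib
import HarnessLib.Audit
import Summits.ValiantsHypothesis.ValiantsHypothesis.Theorems.SoloBlindTwoSum
import Summits.ValiantsHypothesis.ValiantsHypothesis.Theorems.SoloBlindVertexGraph

/-!
# Free removal of dominated atoms in the two-sum model

Validity-free two-sum model of `SoloBlindTwoSum`: atoms `A = I ∖ {0} ⊆ ℤ²`, outer sums `W(I) = (A + A) ∖ I`
(`outerSums`), and strict vertices of `H = conv W(I) + cone A` detected by integer functionals positive on `A`
(`IsStrictVertex`).

An atom `t` is *dominated* (`Dominated I t`) when every integer functional positive on the atoms takes, at some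
outer sum, a value strictly below its value at `t` — the dual way of saying that `t` lies strictly above the lower
boundary chain of `H`.  Results:

* `ne_add_of_weaklyDominated` — a (weakly) dominated atom is never a summand of a strict vertex;
* `IsStrictVertex.erase_of_dominated` — **free removal**: erasing a dominated atom keeps every strict vertex
  strict, with the same functional (the only new outer sum that can appear is the point `t` itself, and the vertex
  functional is smaller at the vertex than at `t`);
* `card_le_of_reduced` / `twoSumFreeLin_of_reducedLin` — hence a linear bound on the number of strict vertices
  need only be proved for *reduced* instances (`Reduced I`: no dominated atom; conjecture `TwoSumReducedLin`);
* the validity-free linear conjecture `TwoSumFreeLin` and the sharp **doubling conjecture** `TwoSumDoubling`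
  (`#V ≤ #A + #{a ∈ A : a + a ∈ I}`; equality is attained by pure-doubling configurations, e.g. nineteen atoms
  whose only additive relations are five disjoint doublings carry twenty-four strict vertices), with
  `TwoSumDoubling → TwoSumFreeLin → TwoSumVertexBoundLin`.

References: Koiran–Portier–Tavenas–Thomassé 2015 (arXiv:1308.2286) §5, problem 1 (the lattice kernel this
model abstracts; see `SoloBlindTwoSum`).
-/

namespace Summit.ValiantsHypothesis.ValiantsHypothesis.Theorems

open Finset

/-- `t` is dominated in `I`: every integer functional positive on the atoms `I ∖ 0` takes, at some outer sum, a
value strictly below its value at `t`. -/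
def Dominated (I : Finset (ℤ × ℤ)) (t : ℤ × ℤ) : Prop :=
  ∀ a b : ℤ, (∀ e ∈ I.erase 0, 0 < lin a b e) → ∃ w ∈ outerSums I, lin a b w < lin a b t

/-- `t` is weakly dominated in `I`: as `Dominated`, with a non-strict inequality. -/
def WeaklyDominated (I : Finset (ℤ × ℤ)) (t : ℤ × ℤ) : Prop :=
  ∀ a b : ℤ, (∀ e ∈ I.erase 0, 0 < lin a b e) → ∃ w ∈ outerSums I, lin a b w ≤ lin a b t

/-- `I` is reduced: none of its atoms is dominated. -/
def Reduced (I : Finset (ℤ × ℤ)) : Prop :=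
  ∀ t ∈ I.erase 0, ¬ Dominated I t

/-- A dominated point is weakly dominated. -/
theorem Dominated.weakly {I : Finset (ℤ × ℤ)} {t : ℤ × ℤ} (h : Dominated I t) :
    WeaklyDominated I t := by
  intro a b hpos
  obtain ⟨w, hw, hlt⟩ := h a b hpos
  exact ⟨w, hw, hlt.le⟩

/-- An outer sum of `I ∖ t` is an outer sum of `I`, or the point `t` itself (which may become an outer sum once it
is no longer an element of `I`). -/
theorem mem_outerSums_erase {I : Finset (ℤ × ℤ)} {t w : ℤ × ℤ} (hw : w ∈ outerSums (I.erase t)) :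
    w ∈ outerSums I ∨ w = t := by
  rw [mem_outerSums] at hw
  obtain ⟨⟨p, hp, q, hq, rfl⟩, hnot⟩ := hw
  by_cases hpt : p + q = t
  · exact Or.inr hpt
  · left
    have hsub : (I.erase t).erase 0 ⊆ I.erase 0 :=
      Finset.erase_subset_erase (0 : ℤ × ℤ) (Finset.erase_subset t I)
    rw [mem_outerSums]
    refine ⟨⟨p, hsub hp, q, hsub hq, rfl⟩, ?_⟩
    intro hmem
    exact hnot (Finset.mem_erase.mpr ⟨hpt, hmem⟩)

/-- A weakly dominated point is never a summand of a strict vertex. -/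
theorem ne_add_of_weaklyDominated {I : Finset (ℤ × ℤ)} {t v z : ℤ × ℤ} (ht : WeaklyDominated I t)
    (hv : IsStrictVertex I v) (hz : z ∈ I.erase 0) : v ≠ t + z := by
  obtain ⟨_, a, b, hpos, huniq⟩ := hv
  obtain ⟨w₀, hw₀, hle⟩ := ht a b hpos
  have h1 : lin a b v ≤ lin a b w₀ := le_of_witness huniq hw₀
  have h2 : 0 < lin a b z := hpos z hz
  intro h
  have h3 : lin a b v = lin a b t + lin a b z := by rw [h, lin_add]
  omega

/-- **Free-removal lemma.**  Erasing a dominated point `t` of `I` keeps every strict vertex of `I` a strict vertex of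
`I ∖ t`, with the same functional. -/
theorem IsStrictVertex.erase_of_dominated {I : Finset (ℤ × ℤ)} {t v : ℤ × ℤ} (hv : IsStrictVertex I v)
    (ht : Dominated I t) : IsStrictVertex (I.erase t) v := by
  obtain ⟨hvW, a, b, hpos, huniq⟩ := hv
  obtain ⟨w₀, hw₀, hw₀t⟩ := ht a b hpos
  have hvt : lin a b v < lin a b t := lt_of_le_of_lt (le_of_witness huniq hw₀) hw₀t
  have hsub : (I.erase t).erase 0 ⊆ I.erase 0 :=
    Finset.erase_subset_erase (0 : ℤ × ℤ) (Finset.erase_subset t I)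
  rw [mem_outerSums] at hvW
  obtain ⟨⟨p, hp, q, hq, hpq⟩, hvI⟩ := hvW
  have hsum : lin a b v = lin a b p + lin a b q := by rw [← hpq, lin_add]
  have hp0 : 0 < lin a b p := hpos p hp
  have hq0 : 0 < lin a b q := hpos q hq
  -- neither summand of `v` is `t`: otherwise `lin v > lin t`.
  have hpt : p ≠ t := by
    rintro rfl
    omega
  have hqt : q ≠ t := by
    rintro rfl
    omega
  refine ⟨?_, a, b, ?_, ?_⟩
  · rw [mem_outerSums]
    refine ⟨⟨p, ?_, q, ?_, hpq⟩, ?_⟩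
    · exact Finset.mem_erase.mpr
        ⟨(Finset.mem_erase.mp hp).1, Finset.mem_erase.mpr ⟨hpt, (Finset.mem_erase.mp hp).2⟩⟩
    · exact Finset.mem_erase.mpr
        ⟨(Finset.mem_erase.mp hq).1, Finset.mem_erase.mpr ⟨hqt, (Finset.mem_erase.mp hq).2⟩⟩
    · intro h
      exact hvI (Finset.mem_of_mem_erase h)
  · intro e he
    exact hpos e (hsub he)
  · intro w hw hne
    rcases mem_outerSums_erase hw with h | rfl
    · exact huniq w h hne
    · exact hvt

/-- **Validity-free linear two-sum bound** (conjecture, not asserted): the number of strict vertices is at most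
linear in the number of atoms, with no validity hypothesis on `I`. -/
@[conjecture] def TwoSumFreeLin : Prop :=
  ∃ c : ℕ, ∀ I V : Finset (ℤ × ℤ), (∀ v ∈ V, IsStrictVertex I v) → V.card ≤ c * (I.erase 0).card

/-- **Doubling conjecture** (sharp form, not asserted): the number of strict vertices is at most the number of atoms
plus the number of *doubled* atoms `a` (those with `a + a ∈ I`).  Numerically unviolated and attained with
equality by pure-doubling configurations. -/
@[conjecture] def TwoSumDoubling : Prop :=
  ∀ I V : Finset (ℤ × ℤ), (∀ v ∈ V, IsStrictVertex I v) →
    V.card ≤ (I.erase 0).card + ((I.erase 0).filter (fun a => a + a ∈ I)).card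

/-- The doubling conjecture implies the validity-free linear bound with constant `2`. -/
theorem twoSumFreeLin_of_doubling (h : TwoSumDoubling) : TwoSumFreeLin := by
  refine ⟨2, fun I V hV => ?_⟩
  have h1 := h I V hV
  have h2 : ((I.erase 0).filter (fun a => a + a ∈ I)).card ≤ (I.erase 0).card :=
    Finset.card_filter_le _ _
  omega

/-- The validity-free linear bound implies `TwoSumVertexBoundLin` (same constant). -/
theorem twoSumVertexBoundLin_of_freeLin (h : TwoSumFreeLin) : TwoSumVertexBoundLin := by
  obtain ⟨c, hc⟩ := h
  refine ⟨c, fun I V _ _ hV => ?_⟩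
  calc V.card ≤ c * (I.erase 0).card := hc I V hV
    _ ≤ c * I.card := Nat.mul_le_mul_left c (Finset.card_erase_le)

/-- **Reduction to reduced instances.**  If a linear bound on the number of strict vertices holds for every reduced
instance, it holds for every instance: erase dominated atoms one at a time (free removal). -/
theorem card_le_of_reduced (c : ℕ)
    (h : ∀ I V : Finset (ℤ × ℤ), Reduced I → (∀ v ∈ V, IsStrictVertex I v) →
      V.card ≤ c * (I.erase 0).card) :
    ∀ (n : ℕ) (I V : Finset (ℤ × ℤ)), (I.erase 0).card = n → (∀ v ∈ V, IsStrictVertex I v) →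
      V.card ≤ c * (I.erase 0).card := by
  intro n
  induction n using Nat.strong_induction_on with
  | _ n ih =>
    intro I V hn hV
    by_cases hred : Reduced I
    · exact h I V hred hV
    · unfold Reduced at hred
      push Not at hred
      obtain ⟨t, ht, hdom⟩ := hred
      have hV' : ∀ v ∈ V, IsStrictVertex (I.erase t) v :=
        fun v hv => (hV v hv).erase_of_dominated hdom
      have hcomm : (I.erase t).erase 0 = (I.erase 0).erase t := Finset.erase_right_comm
      have hct : ((I.erase 0).erase t).card = (I.erase 0).card - 1 := Finset.card_erase_of_mem ht
      have hpos : 0 < (I.erase 0).card := Finset.card_pos.mpr ⟨t, ht⟩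
      have hlt : ((I.erase t).erase 0).card < n := by
        rw [hcomm, hct]; omega
      have hrec := ih _ hlt (I.erase t) V rfl hV'
      calc V.card ≤ c * ((I.erase t).erase 0).card := hrec
        _ ≤ c * (I.erase 0).card := Nat.mul_le_mul_left c (by rw [hcomm, hct]; omega)

/-- **Linear bound for reduced instances** (conjecture, not asserted): the restriction of `TwoSumFreeLin` to
reduced instances — every atom lies weakly below the boundary chain in some direction of the dual cone. -/
@[conjecture] def TwoSumReducedLin : Prop :=
  ∃ c : ℕ, ∀ I V : Finset (ℤ × ℤ), Reduced I → (∀ v ∈ V, IsStrictVertex I v) →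
    V.card ≤ c * (I.erase 0).card

/-- The validity-free linear conjecture follows from its restriction to reduced instances (same constant). -/
theorem twoSumFreeLin_of_reducedLin (h : TwoSumReducedLin) : TwoSumFreeLin := by
  obtain ⟨c, hc⟩ := h
  exact ⟨c, fun I V hV => card_le_of_reduced c hc _ I V rfl hV⟩

end Summit.ValiantsHypothesis.ValiantsHypothesis.Theorems
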